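import Summits.SmoothPoincare4.SmoothPoincare4.Theorems.SymplecticOrigamiOrigamiFoldExistenceStubOuterSideLemma

/-!
# Stub `stub_outerCleanRecognitionOfSide` of line `shadow-pleats` for crux `OrigamiFoldExistence` — Σ:
# the structure map is INJECTIVE on `K = M ∖ e₀(B₂)` with image the closed exterior, BY COVERINGS
(item stmt-SmoothPoincare4-7844, route SymplecticOrigami; seat c5, lead)

With the side lemma O1 a theorem (`…StubOuterSideLemma`: the open outer collar is lifted into the EXTERIOR of the
lifted outer crease), the covering method that proved it also yields the two facts about the structure map
`Ψ = psiMap ι δ C` (file Q `…ChartPsi`) that the cut-at-`R` construction of S4''σ consumes — with NO sheet counting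
(files J/K/L of the chart worker are bypassed):

* `psiMap_injOn_and_image` — for a compact connected `M` in a `1`-chart pleated position with outer-clean chart,
  tube data `D`, a cap map `C` (all five hypotheses of file Q incl. `hCinj`) and the collar package read on the
  exterior side: `Ψ` is INJECTIVE on `K = M ∖ e₀(B₂)` and `Ψ(K) = (chimney D)ᶜ`.
  PROOF.  `Ψ|K` is a covering over the exterior (Mathlib `IsCoveringMapOn.of_isLocalHomeomorphOn`, file β); the
  exterior is path connected (Brown, Literature `SphereHypersurfaceSidesSimplyConnected`) and the fibre over the
  north pole is ONE point (the round point under it: `hCim`, `hCinj`), so `Ψ|K` is injective over the exterior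
  (`CoveringSpaces.injective_of_isCoveringMap_of_subsingleton_fiber` — fibre transport, no `π₁`).  Hence NO FAR
  SHEET PASSES OVER THE CREASE: near a point of `Kₒ = M ∖ e₀(B̄₂)` over the crease, `Ψ` is open, so it takes exterior
  values in the tube, which are lifted shadows of collar points (local surjectivity) — two preimages over the
  exterior.  Hence NO POINT OF `K` GOES INTO THE CHIMNEY: `Kₒ ∩ Ψ⁻¹(chimney)` is then clopen in `M` and misses the
  round point over `N`.  Injectivity on `K` follows (over the crease only `e₀(S₂)`, where the chart shadow is
  injective by outer-cleanness), and `Ψ(K) ⊇ exterior` because a covering image is clopen.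
* `injOn_psiMap_K`, `image_psiMap_K` — the same from `IsPleatedPosition`, outer-cleanness and the cap map alone
  (collar package `exists_collarSide` + O1 `liftS4_chartShadow_mem_exterior`).

Sources: SideLemma-covering-c5.md §4 (Remark); the r8 docstring of `stub_outerCleanRecognitionOfSide`
(`Cruxes/OrigamiFoldExistence/Lines/shadow_pleats.lean`).
-/

noncomputable section

-- the prescribed namespace `Summit.<P>.<Sub>.…` duplicates `SmoothPoincare4` (P = Sub)
set_option linter.dupNamespace false

open scoped Manifold ContDiff Topology RealInnerProductSpace
open Set Function Filter Metric
open Literature.Topology.FourManifolds Literature.Topology.FourManifolds.SphereHypersurfaceSides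

namespace Summit.SmoothPoincare4.SmoothPoincare4.Theorems.OrigamiFoldExistence.ShadowPleats

section Cover

variable {M : Type} [TopologicalSpace M] [T2Space M] [ChartedSpace (EuclideanSpace ℝ (Fin 4)) M]
  [IsManifold (𝓡 4) ∞ M]
  {ι : M → EuclideanSpace ℝ (Fin 5)} {δ : ℝ} {e : Fin 1 → EuclideanSpace ℝ (Fin 4) → M}
  {C : EuclideanSpace ℝ (Fin 5) → Metric.sphere (0 : EuclideanSpace ℝ (Fin 5)) 1}

/-- **THE STRUCTURE MAP IS INJECTIVE ON `K = M ∖ e₀(B₂)` WITH IMAGE THE CLOSED EXTERIOR** (covering proof; the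
collar package is read on the exterior side, which O1 provides). [folklore] -/
theorem psiMap_injOn_and_image [CompactSpace M] [ConnectedSpace M]
    (hpos : IsPleatedPosition ι δ e) (hclean : Set.InjOn (proj5 ∘ ι ∘ e 0) (Metric.sphere 0 2))
    (D : TubeData (liftedCrease ι (e 0)))
    (hCs : ∀ p : EuclideanSpace ℝ (Fin 5), p 4 < 1 →
      ContMDiffAt 𝓘(ℝ, EuclideanSpace ℝ (Fin 5)) (𝓡 4) ∞ C p)
    (hCband : ∀ p : EuclideanSpace ℝ (Fin 5), ‖p‖ = 1 → (1 - δ) / 2 ≤ p 4 → p 4 < 1 →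
      C p = liftS4 (proj5 p))
    (hCd : ∀ p : EuclideanSpace ℝ (Fin 5), ‖p‖ = 1 → p 4 ≤ 1 - δ → ∀ w : EuclideanSpace ℝ (Fin 5),
      ⟪p, w⟫ = 0 → mfderiv 𝓘(ℝ, EuclideanSpace ℝ (Fin 5)) (𝓡 4) C p w = 0 → w = 0)
    (hCinj : InjOn C {q : EuclideanSpace ℝ (Fin 5) | ‖q‖ = 1 ∧ q 4 ≤ 1 - δ})
    (hCim : C '' {q : EuclideanSpace ℝ (Fin 5) | ‖q‖ = 1 ∧ q 4 ≤ 1 - δ} =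
      (liftS4 '' Metric.ball 0 (Real.sqrt (1 - (1 - δ) ^ 2)))ᶜ)
    {κ t₀ : ℝ} (hκ : 0 < κ) (ht₀ : 0 < t₀) (ht₀1 : t₀ ≤ 1 / 4)
    (hext : ∀ u : EuclideanSpace ℝ (Fin 4), 2 < ‖u‖ → ‖u‖ < 2 + κ →
      liftS4 ((proj5 ∘ ι ∘ e 0) u) ∈ exterior D)
    (hsurj : ∀ (x : Metric.sphere (0 : EuclideanSpace ℝ (Fin 4)) 1) (t : ℝ), 0 ≤ poleSign D * t →
      poleSign D * t ≤ t₀ → ∃ u : EuclideanSpace ℝ (Fin 4), 2 ≤ ‖u‖ ∧ ‖u‖ ≤ 2 + κ / 2 ∧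
        liftS4 ((proj5 ∘ ι ∘ e 0) u) = D.τ (x, t • SphereHypersurfaceSides.e₀)) :
    Set.InjOn (psiMap ι δ C) {m : M | m ∉ e 0 '' Metric.ball 0 2} ∧
      psiMap ι δ C '' {m : M | m ∉ e 0 '' Metric.ball 0 2} = (chimney D)ᶜ := by
  classical
  set G : EuclideanSpace ℝ (Fin 4) → EuclideanSpace ℝ (Fin 4) := proj5 ∘ ι ∘ e 0 with hGdef
  have hN : northPole ∉ range (liftedCrease ι (e 0)) := northPole_notMem_range_liftedCrease ι (e 0)
  have hpos' := hpos
  obtain ⟨hι, hδ, hδ1, hround, hcharts, -, -, -⟩ := hpos'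
  have he : Manifold.IsSmoothEmbedding (𝓡 4) (𝓡 4) ∞ (e 0) := (hcharts 0).1
  have heinj : Injective (e 0) := he.isEmbedding.injective
  have hecont : Continuous (e 0) := he.contMDiff.continuous
  have heopen : IsOpenMap (e 0) := isOpenMap_pleatChart he
  have habove : ∀ v, 1 - δ < ι (e 0 v) 4 := (hcharts 0).2
  -- the structure map
  set Ψ : M → Metric.sphere (0 : EuclideanSpace ℝ (Fin 5)) 1 := psiMap ι δ C with hΨdef
  have hΨcont : Continuous Ψ := (contMDiff_psiMap hι hδ hδ1 hround hCs hCband).continuous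
  have hΨe : ∀ v, Ψ (e 0 v) = liftS4 (G v) := fun v => psiMap_of_lt (habove v)
  have hcrease : ∀ v : EuclideanSpace ℝ (Fin 4), ‖v‖ = 2 → liftS4 (G v) ∈ range (liftedCrease ι (e 0)) := by
    intro v hv
    rw [range_liftedCrease]
    exact ⟨v, mem_sphere_zero_iff_norm.2 hv, rfl⟩
  have hpole := poleSign_eq_or D hN
  have hcollar_ext : ∀ v : EuclideanSpace ℝ (Fin 4), 2 < ‖v‖ → ‖v‖ < 2 + κ → Ψ (e 0 v) ∈ exterior D := by
    intro v hv2 hvκ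
    rw [hΨe]
    exact hext v hv2 hvκ
  /- ### `K`, `Kₒ` -/
  set K : Set M := {m | m ∉ e 0 '' Metric.ball 0 2} with hKdef
  set Kₒ : Set M := {m | m ∉ e 0 '' Metric.closedBall 0 2} with hKₒdef
  have hKₒK : Kₒ ⊆ K := fun m hm h => hm (image_mono ball_subset_closedBall h)
  have hKclosed : IsClosed K := (heopen _ isOpen_ball).isClosed_compl
  have hKₒopen : IsOpen Kₒ := ((isCompact_closedBall (0 : EuclideanSpace ℝ (Fin 4)) 2).image hecont).isClosed.isOpen_compl
  haveI : CompactSpace K := isCompact_iff_compactSpace.1 hKclosed.isCompact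
  have heK : ∀ v : EuclideanSpace ℝ (Fin 4), 2 ≤ ‖v‖ → e 0 v ∈ K := by
    rintro v hv ⟨v', hv', hvv'⟩
    rw [heinj hvv'] at hv'
    exact absurd (mem_ball_zero_iff.1 hv') (not_lt.2 hv)
  have hKsphere : ∀ m ∈ K, m ∉ Kₒ → ∃ v : EuclideanSpace ℝ (Fin 4), ‖v‖ = 2 ∧ e 0 v = m := by
    intro m hmK hmKₒ
    simp only [hKₒdef, mem_setOf_eq, not_not] at hmKₒ
    obtain ⟨v, hv, rfl⟩ := hmKₒ
    refine ⟨v, le_antisymm (mem_closedBall_zero_iff.1 hv) ?_, rfl⟩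
    by_contra hlt
    exact hmK ⟨v, mem_ball_zero_iff.2 (not_le.1 hlt), rfl⟩
  -- a point of `K` over the complement of the crease lies in `Kₒ`
  have hKₒ_of : ∀ m ∈ K, Ψ m ∉ range (liftedCrease ι (e 0)) → m ∈ Kₒ := by
    intro m hmK hmc
    by_contra hmKₒ
    obtain ⟨v, hv, rfl⟩ := hKsphere m hmK hmKₒ
    exact hmc (by rw [hΨe]; exact hcrease v hv)
  /- ### the round point over the north pole -/
  have hNmem : northPole ∈ (liftS4 '' Metric.ball 0 (Real.sqrt (1 - (1 - δ) ^ 2)))ᶜ := by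
    rintro ⟨y, -, hy⟩
    exact liftS4_ne_northPole y hy
  rw [← hCim] at hNmem
  obtain ⟨q, ⟨hq1, hq4⟩, hqN⟩ := hNmem
  obtain ⟨s₀, hs₀⟩ := mem_range_of_mem_sphere hround (by simpa using hq1) hq4
  have hΨs₀ : Ψ s₀ = northPole := by
    rw [← hqN, ← hs₀]
    exact psiMap_of_le (by rw [hs₀]; exact hq4)
  have hs₀K : s₀ ∈ K := by
    rintro ⟨v, -, hv⟩
    have h1 := habove v
    rw [hv, hs₀] at h1
    linarith
  -- it is the only point of `M` over the north pole
  have hfibre : ∀ m : M, Ψ m = northPole → m = s₀ := by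
    intro m hm
    by_cases hle : ι m 4 ≤ 1 - δ
    · have hm' : C (ι m) = northPole := by rw [← hm]; exact (psiMap_of_le hle).symm
      have hsm : ‖ι m‖ = 1 := by simpa using mem_sphere_of_apply_le hround hle
      have := hCinj ⟨hsm, hle⟩ ⟨hq1, hq4⟩ (hm'.trans hqN.symm)
      exact hι.isEmbedding.injective (this.trans hs₀.symm)
    · exfalso
      have : Ψ m = liftS4 (proj5 (ι m)) := psiMap_of_lt (not_le.1 hle)
      exact liftS4_ne_northPole _ (this.symm.trans hm)
  /- ### `F = Ψ|K` is an injective covering over the exterior -/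
  set F : K → Metric.sphere (0 : EuclideanSpace ℝ (Fin 5)) 1 := fun k => Ψ k with hFdef
  have hFcont : Continuous F := hΨcont.comp continuous_subtype_val
  have hpre : F ⁻¹' exterior D ⊆ {k : K | (k : M) ∈ Kₒ} := fun k hk =>
    hKₒ_of k k.2 (fun hc => (disjoint_exterior_range D hN).le_bot ⟨hk, hc⟩)
  have hloc : IsLocalHomeomorphOn F (F ⁻¹' exterior D) :=
    (isLocalHomeomorphOn_restrict_psiMap hpos hCs hCband hCd).mono hpre
  have hcov : IsCoveringMapOn F (exterior D) := IsCoveringMapOn.of_isLocalHomeomorphOn hFcont hloc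
  have hcov' : IsCoveringMap ((exterior D).restrictPreimage F) := hcov.isCoveringMap_restrictPreimage
  set F' : F ⁻¹' exterior D → exterior D := (exterior D).restrictPreimage F with hF'def
  -- the exterior is path connected
  haveI : LocallyPathConnectedSpace (exterior D) := by
    rcases hpole with hp | hp
    · have hset : exterior D = {z | 0 < D.sideFun z} := by
        ext z; simp [exterior, sideσ, hp]
      rw [hset]
      exact D.locallyPathConnectedSpace_setOf_sideFun_pos (by norm_num)
    · have hset : exterior D = {z | D.sideFun z < 0} := by
        ext z; simp [exterior, sideσ, hp]
      rw [hset]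
      exact D.locallyPathConnectedSpace_setOf_sideFun_neg (by norm_num)
  haveI : ConnectedSpace (exterior D) := isConnected_iff_connectedSpace.1 (isConnected_exterior D hN)
  haveI : PathConnectedSpace (exterior D) := pathConnectedSpace_iff_connectedSpace.2 inferInstance
  -- the fibre of `F'` over `N` is a subsingleton, so `F'` is injective
  set n₀ : exterior D := ⟨northPole, northPole_mem_exterior D hN⟩ with hn₀
  have hsub : (F' ⁻¹' {n₀}).Subsingleton := by
    intro a ha b hb
    have ha' : Ψ ((a : K) : M) = northPole := congrArg Subtype.val (mem_singleton_iff.1 ha)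
    have hb' : Ψ ((b : K) : M) = northPole := congrArg Subtype.val (mem_singleton_iff.1 hb)
    exact Subtype.ext (Subtype.ext ((hfibre _ ha').trans (hfibre _ hb').symm))
  have hF'inj : Injective F' :=
    Literature.Topology.CoveringSpaces.injective_of_isCoveringMap_of_subsingleton_fiber hcov' hsub
  -- injectivity of `Ψ` over the exterior
  have hinj_ext : ∀ a ∈ K, ∀ b ∈ K, Ψ a ∈ exterior D → Ψ a = Ψ b → a = b := by
    intro a ha b hb haex hab
    have hbex : Ψ b ∈ exterior D := hab ▸ haex
    have := @hF'inj ⟨⟨a, ha⟩, haex⟩ ⟨⟨b, hb⟩, hbex⟩ (Subtype.ext hab)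
    exact congrArg (fun w : F ⁻¹' exterior D => ((w : K) : M)) this
  /- ### no far sheet passes over the crease -/
  have hcoord : Continuous fun w : EuclideanSpace ℝ (Fin 1) => w 0 :=
    (EuclideanSpace.proj (0 : Fin 1)).continuous
  set 𝒩 : Set (Metric.sphere (0 : EuclideanSpace ℝ (Fin 5)) 1) :=
    D.τ '' (univ ×ˢ {w : EuclideanSpace ℝ (Fin 1) | |w 0| < t₀}) with h𝒩def
  have h𝒩open : IsOpen 𝒩 :=
    D.isOpenEmbedding.isOpenMap _ (isOpen_univ.prod (isOpen_lt (continuous_abs.comp hcoord) continuous_const))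
  have hrange𝒩 : range (liftedCrease ι (e 0)) ⊆ 𝒩 := by
    rintro _ ⟨x, rfl⟩
    refine ⟨(x, 0), ⟨mem_univ _, ?_⟩, D.apply_zero x⟩
    show |(0 : EuclideanSpace ℝ (Fin 1)) 0| < t₀
    simpa using ht₀
  -- an exterior value in `𝒩` is the lifted shadow of a collar point of radius in `(2, 2 + κ/2]`
  have hext𝒩 : ∀ z ∈ exterior D, z ∈ 𝒩 → ∃ v : EuclideanSpace ℝ (Fin 4), 2 < ‖v‖ ∧ ‖v‖ ≤ 2 + κ / 2 ∧
      liftS4 (G v) = z := by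
    rintro z hz ⟨⟨x, w⟩, ⟨-, hw⟩, rfl⟩
    have hw' : |w 0| < t₀ := hw
    have hsf : D.sideFun (D.τ (x, w)) = w 0 := sideFun_tube D x w (by linarith [hw'.le])
    have hpos0 : 0 < poleSign D * w 0 := by
      have : 0 < poleSign D * D.sideFun (D.τ (x, w)) := hz
      rwa [hsf] at this
    have hle : poleSign D * w 0 ≤ t₀ := by
      have : poleSign D * w 0 ≤ |w 0| := by
        rcases hpole with hp | hp
        · rw [hp, one_mul]; exact le_abs_self _
        · rw [hp, neg_one_mul]; exact neg_le_abs _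
      exact this.trans hw'.le
    obtain ⟨v, hv2, hvκ, hveq⟩ := hsurj x (w 0) hpos0.le hle
    rw [SphereHypersurfaceSides.smul_e₀_eq] at hveq
    refine ⟨v, lt_of_le_of_ne hv2 ?_, hvκ, hveq⟩
    intro h2
    have hvc : liftS4 (G v) ∈ range (liftedCrease ι (e 0)) := hcrease v h2.symm
    rw [hveq] at hvc
    exact (disjoint_exterior_range D hN).le_bot ⟨hz, hvc⟩
  have hZ : ∀ m ∈ Kₒ, Ψ m ∉ range (liftedCrease ι (e 0)) := by
    intro m hmKₒ hmc
    obtain ⟨φ, hmφ, hφ⟩ := isLocalHomeomorphOn_psiMap hpos hCs hCband hCd m hmKₒ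
    have hφΨ : ∀ x, Ψ x = φ x := fun x => congr_fun hφ x
    set B : Set M := φ.source ∩ Ψ ⁻¹' 𝒩 ∩ ((e 0 '' Metric.closedBall 0 (2 + κ / 2))ᶜ ∩ Kₒ) with hBdef
    have hBopen : IsOpen B :=
      (φ.open_source.inter (h𝒩open.preimage hΨcont)).inter
        (((isCompact_closedBall (0 : EuclideanSpace ℝ (Fin 4)) (2 + κ / 2)).image hecont).isClosed.isOpen_compl.inter
          hKₒopen)
    have hmB : m ∈ B := by
      refine ⟨⟨hmφ, hrange𝒩 hmc⟩, ?_, hmKₒ⟩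
      rintro ⟨v, hv, rfl⟩
      have hv' := mem_closedBall_zero_iff.1 hv
      by_cases hv2 : ‖v‖ ≤ 2
      · exact hmKₒ ⟨v, mem_closedBall_zero_iff.2 hv2, rfl⟩
      · have hch := hcollar_ext v (not_le.1 hv2) (by linarith)
        exact (disjoint_exterior_range D hN).le_bot ⟨hch, hmc⟩
    -- `Ψ(B)` is an open neighbourhood of the crease point `Ψ m`, so it meets the exterior
    have hΨBopen : IsOpen (Ψ '' B) := by
      rw [show Ψ '' B = φ '' B from image_congr fun x _ => hφΨ x]
      exact φ.isOpen_image_of_subset_source hBopen (fun x hx => hx.1.1)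
    have hfr : Ψ m ∈ frontier (exterior D) := by
      rw [frontier_exterior D hN]
      exact hmc
    obtain ⟨z, hzB, hzex⟩ : (Ψ '' B ∩ exterior D).Nonempty :=
      _root_.mem_closure_iff.1 (frontier_subset_closure hfr) _ hΨBopen ⟨m, hmB, rfl⟩
    obtain ⟨b, hbB, rfl⟩ := hzB
    obtain ⟨v, hv2, hvκ, hveq⟩ := hext𝒩 (Ψ b) hzex hbB.1.2
    have hvK : e 0 v ∈ K := heK v hv2.le
    have hbK : b ∈ K := hKₒK hbB.2.2
    have hvex : Ψ (e 0 v) ∈ exterior D := hcollar_ext v hv2 (by linarith)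
    have heq : e 0 v = b := hinj_ext _ hvK _ hbK hvex (by rw [hΨe, hveq])
    exact hbB.2.1 ⟨v, mem_closedBall_zero_iff.2 hvκ, heq⟩
  /- ### no point of `K` goes into the chimney -/
  have hnochim : ∀ m ∈ K, Ψ m ∉ chimney D := by
    intro m₁ hm₁K hm₁
    set V : Set M := Kₒ ∩ Ψ ⁻¹' chimney D with hVdef
    have hVopen : IsOpen V := hKₒopen.inter ((isOpen_chimney D hN).preimage hΨcont)
    have hVclosed : IsClosed V := by
      refine closure_subset_iff_isClosed.1 fun m hmcl => ?_
      have hmK : m ∈ K := closure_minimal (inter_subset_left.trans hKₒK) hKclosed hmcl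
      have hΨm : Ψ m ∈ closure (chimney D) := by
        have : Ψ '' V ⊆ chimney D := by rintro _ ⟨x, hx, rfl⟩; exact hx.2
        exact closure_mono this (image_closure_subset_closure_image hΨcont ⟨m, hmcl, rfl⟩)
      rw [closure_chimney D hN] at hΨm
      have hΨm' : sideσ D (Ψ m) ≤ 0 := hΨm
      rcases hΨm'.lt_or_eq with hlt | h0
      · -- over the chimney
        have hmKₒ : m ∈ Kₒ :=
          hKₒ_of m hmK fun hc => (disjoint_chimney_range D hN).le_bot ⟨hlt, hc⟩
        exact ⟨hmKₒ, hlt⟩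
      · -- over the crease: impossible in `Kₒ`, and `e₀(S₂)` is not a limit of `V`
        exfalso
        have hmc : Ψ m ∈ range (liftedCrease ι (e 0)) := (sideσ_eq_zero_iff D hN _).1 h0
        by_cases hmKₒ : m ∈ Kₒ
        · exact hZ m hmKₒ hmc
        · obtain ⟨v, hv, rfl⟩ := hKsphere m hmK hmKₒ
          -- the neighbourhood `e₀(B(v, κ))` of `e₀ v`: its `Kₒ`-points are collar points, which go to the exterior
          have hO : IsOpen (e 0 '' Metric.ball v κ) := heopen _ isOpen_ball
          obtain ⟨_, ⟨v', hv', rfl⟩, ⟨hbKₒ, hbch⟩⟩ :=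
            _root_.mem_closure_iff.1 hmcl _ hO ⟨v, mem_ball_self hκ, rfl⟩
          have hv'2 : 2 < ‖v'‖ := by
            by_contra hle
            exact hbKₒ ⟨v', mem_closedBall_zero_iff.2 (not_lt.1 hle), rfl⟩
          have hv'κ : ‖v'‖ < 2 + κ := by
            have := mem_ball_iff_norm.1 hv'
            calc ‖v'‖ = ‖(v' - v) + v‖ := by rw [sub_add_cancel]
              _ ≤ ‖v' - v‖ + ‖v‖ := norm_add_le _ _
              _ < κ + 2 := by linarith
              _ = 2 + κ := by ring
          exact (disjoint_chimney_exterior D).le_bot ⟨hbch, hcollar_ext v' hv'2 hv'κ⟩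
    have hVclopen : IsClopen V := ⟨hVclosed, hVopen⟩
    rcases isClopen_iff.1 hVclopen with hV | hV
    · have : m₁ ∈ V := ⟨hKₒ_of m₁ hm₁K fun hc => (disjoint_chimney_range D hN).le_bot ⟨hm₁, hc⟩, hm₁⟩
      rw [hV] at this
      exact this
    · have : s₀ ∈ V := hV ▸ mem_univ s₀
      have h2 := this.2
      rw [mem_preimage, hΨs₀] at h2
      exact (disjoint_chimney_exterior D).le_bot ⟨h2, northPole_mem_exterior D hN⟩
  /- ### injectivity on `K` -/
  have hinj : Set.InjOn Ψ K := by
    intro a ha b hb hab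
    rcases mem_chimney_or D (Ψ a) with hch | h0 | hex
    · exact absurd hch (hnochim a ha)
    · have hac : Ψ a ∈ range (liftedCrease ι (e 0)) := (sideσ_eq_zero_iff D hN _).1 h0
      have hbc : Ψ b ∈ range (liftedCrease ι (e 0)) := hab ▸ hac
      have haKₒ : a ∉ Kₒ := fun h => hZ a h hac
      have hbKₒ : b ∉ Kₒ := fun h => hZ b h hbc
      obtain ⟨v, hv, rfl⟩ := hKsphere a ha haKₒ
      obtain ⟨v', hv', rfl⟩ := hKsphere b hb hbKₒ
      rw [hΨe, hΨe] at hab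
      have := hclean (mem_sphere_zero_iff_norm.2 hv) (mem_sphere_zero_iff_norm.2 hv') (liftS4_injective hab)
      rw [this]
    · exact hinj_ext a ha b hb hex hab
  /- ### the image -/
  have himage : Ψ '' K = (chimney D)ᶜ := by
    apply Subset.antisymm
    · rintro _ ⟨m, hm, rfl⟩ hch
      exact hnochim m hm hch
    · intro z hz
      rcases mem_chimney_or D z with hch | h0 | hex
      · exact absurd hch hz
      · have hzc : z ∈ range (liftedCrease ι (e 0)) := (sideσ_eq_zero_iff D hN _).1 h0
        rw [range_liftedCrease] at hzc
        obtain ⟨v, hv, rfl⟩ := hzc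
        exact ⟨e 0 v, heK v (mem_sphere_zero_iff_norm.1 hv).symm.le, hΨe v⟩
      · -- the image of the covering `F'` is clopen in the connected exterior, and nonempty
        have hIo : IsOpen (range F') := hcov'.isOpenMap.isOpen_range
        have hIc : IsClosed (range F') := by
          have hcK : IsClosed (Ψ '' K) := (hKclosed.isCompact.image hΨcont).isClosed
          have : range F' = ((↑) : exterior D → Metric.sphere (0 : EuclideanSpace ℝ (Fin 5)) 1) ⁻¹' (Ψ '' K) := by
            ext y
            constructor
            · rintro ⟨w, rfl⟩
              exact ⟨(w : K), (w : K).2, rfl⟩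
            · rintro ⟨m, hmK, hmy⟩
              have hmex : Ψ m ∈ exterior D := by rw [hmy]; exact y.2
              exact ⟨⟨⟨m, hmK⟩, hmex⟩, Subtype.ext hmy⟩
          rw [this]
          exact hcK.preimage continuous_subtype_val
        have hIne : (range F').Nonempty := ⟨F' ⟨⟨s₀, hs₀K⟩, by
          show Ψ s₀ ∈ exterior D
          rw [hΨs₀]; exact northPole_mem_exterior D hN⟩, mem_range_self _⟩
        have hIuniv : range F' = univ := (isClopen_iff.1 ⟨hIc, hIo⟩).resolve_left hIne.ne_empty
        have : (⟨z, hex⟩ : exterior D) ∈ range F' := hIuniv ▸ mem_univ _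
        obtain ⟨w, hw⟩ := this
        exact ⟨(w : K), (w : K).2, congrArg Subtype.val hw⟩
  exact ⟨hinj, himage⟩

/-- **INJECTIVITY AND IMAGE OF THE STRUCTURE MAP WITH THE TREE'S CAP MAP**, from the pleated position and
outer-cleanness alone: the collar package (`exists_collarSide`), the side lemma O1 (`liftS4_chartShadow_mem_exterior`:
the collar sign IS the pole sign), the cap map `capMap δ` (file N) with its immersivity (file O′). [folklore] -/
theorem injOn_and_image_psiMap_capMap [CompactSpace M] [ConnectedSpace M]
    (hpos : IsPleatedPosition ι δ e) (hclean : Set.InjOn (proj5 ∘ ι ∘ e 0) (Metric.sphere 0 2))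
    (D : TubeData (liftedCrease ι (e 0))) :
    Set.InjOn (psiMap ι δ (capMap δ)) {m : M | m ∉ e 0 '' Metric.ball 0 2} ∧
      psiMap ι δ (capMap δ) '' {m : M | m ∉ e 0 '' Metric.ball 0 2} = (chimney D)ᶜ := by
  have hpos' := hpos
  obtain ⟨-, hδ, hδ1, -⟩ := hpos'
  have hN : northPole ∉ range (liftedCrease ι (e 0)) := northPole_notMem_range_liftedCrease ι (e 0)
  -- the cap map
  have hCs : ∀ p : EuclideanSpace ℝ (Fin 5), p 4 < 1 →
      ContMDiffAt 𝓘(ℝ, EuclideanSpace ℝ (Fin 5)) (𝓡 4) ∞ (capMap δ) p := fun _ hp => contMDiffAt_capMap hδ1 hp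
  have hCband : ∀ p : EuclideanSpace ℝ (Fin 5), ‖p‖ = 1 → (1 - δ) / 2 ≤ p 4 → p 4 < 1 →
      capMap δ p = liftS4 (proj5 p) := fun _ hp1 hb hp4 => capMap_eq_liftS4_proj5 hδ1 hp1 hp4 hb
  have hCd : ∀ p : EuclideanSpace ℝ (Fin 5), ‖p‖ = 1 → p 4 ≤ 1 - δ → ∀ w : EuclideanSpace ℝ (Fin 5),
      ⟪p, w⟫ = 0 → mfderiv 𝓘(ℝ, EuclideanSpace ℝ (Fin 5)) (𝓡 4) (capMap δ) p w = 0 → w = 0 :=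
    fun _ hp1 hp4 _ hpw h0 => eq_zero_of_mfderiv_capMap_eq_zero hδ hδ1 hp1 hp4 hpw h0
  -- the collar package and its side
  obtain ⟨κ, t₀, s, hκ, -, ht₀, ht₀1, hs, -, hside, hsurj⟩ := exists_collarSide hpos hclean D
  have hext : ∀ u : EuclideanSpace ℝ (Fin 4), 2 < ‖u‖ → ‖u‖ < 2 + κ →
      liftS4 ((proj5 ∘ ι ∘ e 0) u) ∈ exterior D := fun u hu2 huκ =>
    liftS4_chartShadow_mem_exterior hpos D hCs hCband hCd (image_capMap hδ hδ1) ht₀ ht₀1 hs hside hsurj hu2 huκ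
  -- hence the collar sign is the pole sign
  have hsp : s = poleSign D := by
    set r : ℝ := 2 + κ / 2 with hr
    set u : EuclideanSpace ℝ (Fin 4) := r • EuclideanSpace.single (0 : Fin 4) (1 : ℝ) with hu
    have hnorm : ‖u‖ = r := by
      rw [hu, norm_smul]
      simp [abs_of_pos (show (0 : ℝ) < r by rw [hr]; linarith)]
    have hu2 : 2 < ‖u‖ := by rw [hnorm, hr]; linarith
    have huκ : ‖u‖ < 2 + κ := by rw [hnorm, hr]; linarith
    have h1 : 0 < poleSign D * D.sideFun (liftS4 ((proj5 ∘ ι ∘ e 0) u)) := hext u hu2 huκ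
    have h2 := hside u hu2 huκ
    rcases hs with rfl | rfl <;> rcases poleSign_eq_or D hN with hp | hp <;> rw [hp] at h1 ⊢ <;> nlinarith
  subst hsp
  exact psiMap_injOn_and_image hpos hclean D hCs hCband hCd (injOn_capMap hδ hδ1) (image_capMap hδ hδ1) hκ ht₀ ht₀1
    hext hsurj

end Cover

end Summit.SmoothPoincare4.SmoothPoincare4.Theorems.OrigamiFoldExistence.ShadowPleats

end
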